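import Literature.NumberTheory.GaloisCohomology.PoitouTateSelmerCountProofs
import Literature.NumberTheory.GaloisCohomology.ArchimedeanInvariantMap
import Summits.BirchSwinnertonDyer.Rank1Residual.GaloisImage.SelmerGroupFinite
import HarnessLib

/-!
# Poitou–Tate, the annihilator of `Ш¹` — part 1/3: finite duality, stabilisation of `Ш¹_S`, and the
# representation of a functional on the classes unramified outside `S` (Milne I Thm. 4.10, proof, p. 58)

Cell `bsd-wall`, seat `bsd-line-chl-p2` g5 — width prover on crux K4 `RedSplitControlAtThree`
(stmt-BirchSwinnertonDyer-24200, route `CumulativeHeegnerLeopoldt`), working the registered stub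
`stub_poitouTateShaTateDual` = the named fact `poitouTate_sha_tateDual` (Milne I Thm. 4.10 (a), item 20462),
which K4 consumes only as `#Ш²(K, E[3^k]) ≤ #Ш¹(K, E[3^k]^D)`.  The three files
`…ShaDualFiniteDuality` (this one), `…ShaDualNewPlace`, `…ShaDualAnnihilator` prove, as kernel theorems over
the tree's Galois cohomology, the half of 4.10 (a) that is "finite duality + Poitou–Tate for Selmer
structures": **the annihilator of `Ш¹(K, M^D)` in `Hom(H¹(K, M^D), ℤ/n)` is contained in `γ¹(P¹(K, M))`**
(main theorem `exists_family_sum_localTatePairing_eq` in part 3).  Combined with the identification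
`Ш²(K, M) ≅ coker γ¹` of cell `bsd-schneider`'s Route A (Tate's `α¹` for `C̄`, readout of `P¹`), it yields
`Ш²(K, M) ≅ Ш¹(K, M^D)^*`.

This part (theorems only; no definition, no named fact, no `sorry`):
* §1 `exists_finset_forall_apply_eq_zero` (a finite subgroup killed by a family of maps is killed by
  finitely many of them) and `exists_apply_eq_of_bijective` (characters of a subgroup `B₁ ≤ P` are
  `b(t, ·)|_{B₁}` for a pairing `b : T × P → ℤ/n` with bijective adjoint — the extension property, by the
  count `#B₁^⊥ · #B₁ = #P` of `natCard_annihilator_mul_natCard`);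
* §2 `exists_finset_forall_localization_eq_zero` — **stabilisation of `Ш¹_S`**: for a finite `M` unramified
  off `S₀ ⊇ {v ∣ ∞}` there is a finite `S₁ ⊇ S₀` such that a class unramified off `S₁` and zero on the
  finite part of `S₁` is zero at every finite place (the `Ш¹_S` decrease inside the finite `Ш¹_{S₀}`,
  `SelmerFinite.finite_selmerGroup_of_isUnramifiedOutside`, Milne I Lemma 4.8 / NSW 8.3.20);
* §3 `exists_sum_localTatePairingZMod_eq_of_unramifiedOutside` — for a family `inv` with local Tate
  duality at the finite places (`IsPerfect`): an additive `φ : H¹(K, M^D) → ℤ/n` killing the classes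
  unramified off `S₁` and zero on `S₁` is `y ↦ ∑_{v ∈ S₁,f} inv_v (t¹_v ∪ y_v)` on the classes unramified
  off `S₁` (the local Tate pairings sum to a PERFECT pairing of `∏_{v ∈ S₁,f} H¹(K_v, M)` with
  `∏_{v ∈ S₁,f} H¹(K_v, M^D)`, as in `PoitouTateSelmerCountProofs`; then §1);
* §4 `localization_inl_one_eq_zero_of_isComplex`, `mem_sha_of_forall_localization_inr_eq_zero` —
  `H¹(K_w, M) = 0` at a complex place (`Γ_{K_w} = 1`, `eq_one_absoluteGaloisGroup_of_isComplex`), so for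
  totally complex `K` membership in `Ш¹` is decided at the finite places.

HONEST FRAMING: infrastructure `--supports stmt-BirchSwinnertonDyer-24200`; closes no item; conditional on
nothing beyond the displayed hypotheses; BSD is not proved by any of this.

References: [MilneADT2006] I §0 Prop. 0.19, Cor. 2.3, Lemma 4.8, Thm. 4.10 and its proof;
[NeukirchSchmidtWingberg2008] (8.3.20); [Howard2004HeegnerKolyvagin] Thm. 2.1.11.
-/

noncomputable section

open Function NumberField IsDedekindDomain
open scoped NumberField

universe u

set_option linter.dupNamespace false
set_option autoImplicit false

namespace Summit.BirchSwinnertonDyer.BirchSwinnertonDyer.Theorems.PoitouTateShaAnnihilator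

open Literature.NumberTheory.GaloisRepresentations
open Literature.NumberTheory.GaloisRepresentations.DiscreteGaloisModule (mu localTatePairingZMod tateDual
  unramifiedSubgroup SelmerStructure)
open Literature.NumberTheory.GaloisCohomology

/-! ## §1 Two pieces of finite-group algebra -/

section Algebra

/-- **A finite subgroup that dies under a family of homomorphisms already dies under finitely many of
them, uniformly**: for `G ≤ A` finite and homomorphisms `f_i : A → B_i`, there is a finite set `T` of
indices such that every `x ∈ G` killed by the `f_i`, `i ∈ T`, is killed by all `f_i` (choose a
witness index for each of the finitely many `x ∈ G` outside the common kernel). [folklore] -/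
theorem exists_finset_forall_apply_eq_zero {A : Type*} [AddCommGroup A] {ι : Type*} {B : ι → Type*}
    [∀ i, AddCommGroup (B i)] (f : ∀ i, A →+ B i) (G : AddSubgroup A) [Finite G] :
    ∃ T : Finset ι, ∀ x ∈ G, (∀ i ∈ T, f i x = 0) → ∀ i, f i x = 0 := by
  classical
  have key : ∀ x : G, ∃ T : Finset ι, (∀ i ∈ T, f i x = 0) → ∀ i, f i x = 0 := by
    intro x
    by_cases h : ∀ i, f i x = 0
    · exact ⟨∅, fun _ => h⟩
    · simp only [not_forall] at h
      obtain ⟨i, hi⟩ := h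
      exact ⟨{i}, fun hT => absurd (hT i (Finset.mem_singleton_self i)) hi⟩
  choose T hT using key
  haveI := Fintype.ofFinite G
  refine ⟨Finset.univ.biUnion T, fun x hx hzero i => hT ⟨x, hx⟩ (fun j hj => hzero j ?_) i⟩
  exact Finset.mem_biUnion.2 ⟨⟨x, hx⟩, Finset.mem_univ _, hj⟩

/-- **Functionals on a subgroup are represented through a perfect pairing** (the extension property
of `ℤ/n`-valued characters, by counting): for finite `T`, `P` with `n·P = 0` and a bi-additive
`b : T × P → ℤ/n` whose adjoint `T → Hom(P, ℤ/n)` is bijective, every additive `χ : B₁ → ℤ/n` on a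
subgroup `B₁ ≤ P` is `b(t, ·)|_{B₁}` for some `t ∈ T`: the restriction `T → Hom(B₁, ℤ/n)` has kernel
the annihilator `U` of `B₁`, `#U · #B₁ = #P = #T` (`natCard_annihilator_mul_natCard`), so its image
has `#B₁ = #Hom(B₁, ℤ/n)` elements. [cite: MilneADT2006, Ch. I §0 Prop. 0.19] -/
theorem exists_apply_eq_of_bijective {T P : Type*} [AddCommGroup T] [AddCommGroup P] [Finite T]
    [Finite P] {n : ℕ} [NeZero n] (hP : ∀ p : P, n • p = 0) (b : T →+ P →+ ZMod n)
    (hb : Bijective b) (B₁ : AddSubgroup P) (χ : B₁ →+ ZMod n) :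
    ∃ t : T, ∀ (p : P) (hp : p ∈ B₁), b t p = χ ⟨p, hp⟩ := by
  classical
  -- the restriction map `Θ : T → Hom(B₁, ℤ/n)`
  let Θ : T →+ (B₁ →+ ZMod n) :=
    { toFun := fun t => (b t).comp B₁.subtype
      map_zero' := by ext p; simp
      map_add' := fun t t' => by ext p; simp }
  have hΘ : ∀ t (p : B₁), Θ t p = b t p := fun _ _ => rfl
  -- its kernel is the annihilator `U` of `B₁`
  have hU : ∀ t : T, t ∈ Θ.ker ↔ ∀ p ∈ B₁, b t p = 0 := fun t => by
    rw [AddMonoidHom.mem_ker]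
    constructor
    · intro h p hp
      rw [← hΘ t ⟨p, hp⟩, h, AddMonoidHom.zero_apply]
    · intro h
      ext p
      rw [hΘ, h p p.2, AddMonoidHom.zero_apply]
  have hB₁n : ∀ p : B₁, n • p = 0 := fun p => Subtype.ext (by
    rw [AddSubgroup.coe_nsmul, hP, AddSubgroup.coe_zero])
  haveI : Finite (B₁ →+ ZMod n) := finite_addMonoidHom_zmod B₁ n
  have h1 : Nat.card Θ.ker * Nat.card B₁ = Nat.card P :=
    natCard_annihilator_mul_natCard hP b hb B₁ Θ.ker hU
  have h2 : Nat.card T = Nat.card P := natCard_eq_of_bijective hP b hb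
  have h3 : Nat.card Θ.ker * Θ.ker.index = Nat.card T := AddSubgroup.card_mul_index Θ.ker
  have h4 : Θ.ker.index = Nat.card Θ.range := AddSubgroup.index_ker Θ
  have h5 : Nat.card (B₁ →+ ZMod n) = Nat.card B₁ := Nat.card_addMonoidHom_zmod hB₁n
  have hker0 : Nat.card Θ.ker ≠ 0 := Nat.card_pos.ne'
  have hrange : Nat.card Θ.range = Nat.card (B₁ →+ ZMod n) := by
    apply Nat.eq_of_mul_eq_mul_left (Nat.pos_of_ne_zero hker0)
    rw [← h4, h3, h2, ← h1, h5]
  have htop : Θ.range = ⊤ := AddSubgroup.eq_top_of_card_eq _ hrange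
  have hsurj : Surjective Θ := AddMonoidHom.range_eq_top.1 htop
  obtain ⟨t, ht⟩ := hsurj χ
  exact ⟨t, fun p hp => by rw [← hΘ t ⟨p, hp⟩, ht]⟩

end Algebra

/-! ## §2 Enlarging `S` until `Ш¹_S` stops shrinking -/

section Stabilization

variable {K : Type u} [Field K] [NumberField K] {M : Type u} [AddCommGroup M] [TopologicalSpace M]
  [DiscreteTopology M] [Finite M]

/-- **Stabilisation of `Ш¹_S`.** For a finite discrete `Γ_K`-module `M` unramified outside the finite
set of places `S₀ ⊇ {v ∣ ∞}`, the groups `Ш¹_S = {x ∈ H¹(K, M) : x_v = 0 (v ∈ S finite), x_v unramified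
(v ∉ S finite)}` decrease with `S ⊇ S₀` inside the FINITE group `Ш¹_{S₀}` (finiteness of Selmer groups,
`SelmerFinite.finite_selmerGroup_of_isUnramifiedOutside`), hence are eventually constant: there is a
finite `S₁ ⊇ S₀` such that every class unramified outside `S₁` and vanishing at the finite places of
`S₁` vanishes at EVERY finite place. [cite: MilneADT2006, Ch. I §4, Lemma 4.8] -/
theorem exists_finset_forall_localization_eq_zero (ρ : DiscreteGaloisModule K M)
    (S₀ : Finset (Place K)) (hinf : ∀ w : InfinitePlace K, (Sum.inl w : Place K) ∈ S₀)
    (hur : ∀ v : HeightOneSpectrum (𝓞 K), (Sum.inr v : Place K) ∉ S₀ → GaloisRep.IsUnramifiedAt v ρ) :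
    ∃ S₁ : Finset (Place K), S₀ ⊆ S₁ ∧ ∀ x : galoisCohomology ρ 1,
      (∀ v : HeightOneSpectrum (𝓞 K), (Sum.inr v : Place K) ∈ S₁ →
        galoisCohomology.localization ρ (Sum.inr v) 1 x = 0) →
      (∀ v : HeightOneSpectrum (𝓞 K), (Sum.inr v : Place K) ∉ S₁ →
        galoisCohomology.localization ρ (Sum.inr v) 1 x ∈ unramifiedSubgroup (GaloisRep.toLocal v ρ) 1) →
      ∀ v : HeightOneSpectrum (𝓞 K), galoisCohomology.localization ρ (Sum.inr v) 1 x = 0 := by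
  classical
  -- the Selmer structure "strict at `S₀`, unramified outside"
  let 𝓢 : SelmerStructure ρ := SelmerStructure.ofFinite ρ fun v =>
    if (Sum.inr v : Place K) ∈ S₀ then ⊥ else unramifiedSubgroup (GaloisRep.toLocal v ρ) 1
  have h𝓢 : 𝓢.IsUnramifiedOutside S₀ := ⟨hinf, fun v hv => by
    simp only [𝓢, SelmerStructure.ofFinite_inr, if_neg hv]⟩
  haveI : Finite 𝓢.selmerGroup :=
    Summit.BirchSwinnertonDyer.Rank1Residual.GaloisImage.SelmerFinite.finite_selmerGroup_of_isUnramifiedOutside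
      ρ hur h𝓢
  obtain ⟨T, hT⟩ := exists_finset_forall_apply_eq_zero
    (fun v : HeightOneSpectrum (𝓞 K) => galoisCohomology.localization ρ (Sum.inr v) 1) 𝓢.selmerGroup
  refine ⟨S₀ ∪ T.image Sum.inr, Finset.subset_union_left, fun x hzero hunr => ?_⟩
  have hx : x ∈ 𝓢.selmerGroup := by
    rw [SelmerStructure.mem_selmerGroup_ofFinite_iff]
    intro v
    by_cases hv : (Sum.inr v : Place K) ∈ S₀
    · rw [if_pos hv, hzero v (Finset.mem_union_left _ hv)]
      exact (⊥ : AddSubgroup _).zero_mem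
    · rw [if_neg hv]
      by_cases hv' : (Sum.inr v : Place K) ∈ S₀ ∪ T.image Sum.inr
      · rw [hzero v hv']
        exact AddSubgroup.zero_mem _
      · exact hunr v hv'
  exact hT x hx fun v hv => hzero v (Finset.mem_union_right _ (Finset.mem_image_of_mem _ hv))

end Stabilization

/-! ## §3 Representation of `φ` on the classes unramified outside `S₁` by a vector over `S₁` -/

section OnS

variable {K : Type u} [Field K] [NumberField K] {M : Type u} [AddCommGroup M] [TopologicalSpace M]
  [DiscreteTopology M] [Finite M] {n : ℕ} [NeZero n]

/-- **A functional on the classes unramified outside `S₁` which kills those vanishing on `S₁` is a sum of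
local Tate pairings over the finite places of `S₁`.**  For a family `inv` with local Tate duality at the
finite places (`IsPerfect`), a finite `n`-torsion `M`, a finite set of places `S₁` and an additive
`φ : H¹(K, M^D) → ℤ/n` such that `φ(y) = 0` whenever `y` is unramified off `S₁` and `y_v = 0` at the finite
`v ∈ S₁`: there is a vector `t¹ = (t¹_v)_v`, `t¹_v ∈ H¹(K_v, M)`, with
`φ(y) = ∑_{v ∈ S₁ finite} inv_v (t¹_v ∪ y_v)` for every `y` unramified off `S₁`.  Proof: `φ` restricted to
`A₁ = {y unramified off S₁}` factors through the image of `A₁ → ∏_{v ∈ S₁,f} H¹(K_v, M^D)`; the sum of the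
local Tate pairings is a perfect pairing of the finite products (`IsPerfect` at each `v`), and characters of
a subgroup are represented (`exists_apply_eq_of_bijective`).
[cite: MilneADT2006, Ch. I, Cor. 2.3 and Thm. 4.10, proof (p. 58)] -/
theorem exists_sum_localTatePairingZMod_eq_of_unramifiedOutside {inv : LocalInvariants K n}
    (hperf : inv.IsPerfect) (ρ : DiscreteGaloisModule K M) (hM : ∀ m : M, n • m = 0)
    (S₁ : Finset (Place K)) (φ : galoisCohomology (ρ.tateDual n) 1 →+ ZMod n)
    (hφ : ∀ y : galoisCohomology (ρ.tateDual n) 1,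
      (∀ v : HeightOneSpectrum (𝓞 K), (Sum.inr v : Place K) ∉ S₁ →
        galoisCohomology.localization (ρ.tateDual n) (Sum.inr v) 1 y ∈
          unramifiedSubgroup (GaloisRep.toLocal v (ρ.tateDual n)) 1) →
      (∀ v : HeightOneSpectrum (𝓞 K), (Sum.inr v : Place K) ∈ S₁ →
        galoisCohomology.localization (ρ.tateDual n) (Sum.inr v) 1 y = 0) → φ y = 0) :
    ∃ t1 : Π v : HeightOneSpectrum (𝓞 K), galoisCohomology (ρ.toLocal (Sum.inr v)) 1,
      ∀ y : galoisCohomology (ρ.tateDual n) 1,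
        (∀ v : HeightOneSpectrum (𝓞 K), (Sum.inr v : Place K) ∉ S₁ →
          galoisCohomology.localization (ρ.tateDual n) (Sum.inr v) 1 y ∈
            unramifiedSubgroup (GaloisRep.toLocal v (ρ.tateDual n)) 1) →
        φ y = ∑ v ∈ S₁.preimage Sum.inr Sum.inr_injective.injOn,
          localTatePairingZMod ρ n (Sum.inr v) (inv (Sum.inr v)) (t1 v)
            (galoisCohomology.localization (ρ.tateDual n) (Sum.inr v) 1 y) := by
  classical
  -- the finite part `Sf` of `S₁`, local groups, the perfect sum pairing (as in `PoitouTateSelmerCountProofs`)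
  set Sf : Finset (HeightOneSpectrum (𝓞 K)) := S₁.preimage Sum.inr Sum.inr_injective.injOn with hSfdef
  have hSf : ∀ v : HeightOneSpectrum (𝓞 K), v ∈ Sf ↔ (Sum.inr v : Place K) ∈ S₁ := fun v =>
    Finset.mem_preimage
  let Av : Sf → Type u := fun v => galoisCohomology (ρ.toLocal (Sum.inr (v : HeightOneSpectrum (𝓞 K)))) 1
  let Bv : Sf → Type u := fun v =>
    galoisCohomology ((ρ.tateDual n).toLocal (Sum.inr (v : HeightOneSpectrum (𝓞 K)))) 1
  haveI hfinA : ∀ v : Sf, Finite (Av v) := fun v => finite_galoisCohomology_one_toLocal ρ v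
  haveI hfinB : ∀ v : Sf, Finite (Bv v) := fun v => finite_galoisCohomology_one_tateDual_toLocal ρ n v
  let Pv : ∀ v : Sf, Av v →+ Bv v →+ ZMod n :=
    fun v => localTatePairingZMod ρ n (Sum.inr (v : HeightOneSpectrum (𝓞 K))) (inv (Sum.inr v))
  have hPbij : ∀ v : Sf, Bijective (Pv v) := fun v => ((hperf v).2 ρ hM).1
  have hAn : ∀ t : (∀ v, Av v), n • t = 0 := fun t => funext fun v => by
    rw [Pi.smul_apply, Pi.zero_apply]; exact galoisCohomology.nsmul_eq_zero_of_forall _ hM _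
  have hBn : ∀ u : (∀ v, Bv v), n • u = 0 := fun u => funext fun v => by
    rw [Pi.smul_apply, Pi.zero_apply]
    exact galoisCohomology.nsmul_eq_zero_of_forall _ (fun f => DiscreteGaloisModule.TateDual.nsmul_eq_zero f) _
  let bS : (∀ v, Av v) →+ (∀ v, Bv v) →+ ZMod n :=
    ∑ v : Sf, ((Pv v).comp (Pi.evalAddMonoidHom Av v)).compl₂ (Pi.evalAddMonoidHom Bv v)
  have hbS : ∀ t u, bS t u = ∑ v, Pv v (t v) (u v) := fun t u => by
    simp only [bS, AddMonoidHom.finsetSum_apply, AddMonoidHom.compl₂_apply, AddMonoidHom.comp_apply,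
      Pi.evalAddMonoidHom_apply]
  have hbS_single_right : ∀ (t : ∀ v, Av v) (i : Sf) (b : Bv i), bS t (Pi.single i b) = Pv i (t i) b := by
    intro t i b
    rw [hbS, Finset.sum_eq_single i]
    · rw [Pi.single_eq_same]
    · intro j _ hj; rw [Pi.single_eq_of_ne hj, map_zero]
    · intro h; exact absurd (Finset.mem_univ i) h
  have hbS_single_left : ∀ (i : Sf) (a : Av i) (u : ∀ v, Bv v), bS (Pi.single i a) u = Pv i a (u i) := by
    intro i a u
    rw [hbS, Finset.sum_eq_single i]
    · rw [Pi.single_eq_same]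
    · intro j _ hj; rw [Pi.single_eq_of_ne hj, map_zero, AddMonoidHom.zero_apply]
    · intro h; exact absurd (Finset.mem_univ i) h
  have hinj₁ : Injective bS := by
    intro t t' h
    funext i
    apply (hPbij i).1
    ext b
    have := DFunLike.congr_fun h (Pi.single i b)
    rwa [hbS_single_right, hbS_single_right] at this
  have hinj₂ : Injective bS.flip := by
    intro u u' h
    funext i
    apply ((hperf i).2 ρ hM).2.1
    ext a
    have := DFunLike.congr_fun h (Pi.single i a)
    rw [AddMonoidHom.flip_apply, AddMonoidHom.flip_apply, hbS_single_left, hbS_single_left] at this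
    rwa [AddMonoidHom.flip_apply, AddMonoidHom.flip_apply]
  have hbSbij : Bijective bS :=
    (AddMonoidHom.bijective_of_injective_of_injective_flip hAn hBn bS hinj₁ hinj₂).1
  -- the global side: `A₁ = {y unramified off S₁}`, `β₁ : H¹(K, M^D) → ∏_{v ∈ Sf} H¹(K_v, M^D)`
  let 𝓣 : SelmerStructure (ρ.tateDual n) := SelmerStructure.ofFinite (ρ.tateDual n) fun v =>
    if (Sum.inr v : Place K) ∈ S₁ then ⊤ else unramifiedSubgroup (GaloisRep.toLocal v (ρ.tateDual n)) 1
  have h𝓣top : ∀ v : HeightOneSpectrum (𝓞 K), (Sum.inr v : Place K) ∈ S₁ → 𝓣 (Sum.inr v) = ⊤ :=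
    fun v hv => by simp only [𝓣, SelmerStructure.ofFinite_inr, if_pos hv]; rfl
  have h𝓣ur : ∀ v : HeightOneSpectrum (𝓞 K), (Sum.inr v : Place K) ∉ S₁ →
      𝓣 (Sum.inr v) = unramifiedSubgroup (GaloisRep.toLocal v (ρ.tateDual n)) 1 :=
    fun v hv => by simp only [𝓣, SelmerStructure.ofFinite_inr, if_neg hv]
  have hmem𝓣 : ∀ y : galoisCohomology (ρ.tateDual n) 1, y ∈ 𝓣.selmerGroup ↔
      ∀ v : HeightOneSpectrum (𝓞 K), (Sum.inr v : Place K) ∉ S₁ →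
        galoisCohomology.localization (ρ.tateDual n) (Sum.inr v) 1 y ∈
          unramifiedSubgroup (GaloisRep.toLocal v (ρ.tateDual n)) 1 := by
    intro y
    rw [SelmerStructure.mem_selmerGroup_iff]
    constructor
    · intro h v hv
      have h' := h (Sum.inr v)
      rwa [h𝓣ur v hv] at h'
    · intro h v
      cases v with
      | inl w => exact AddSubgroup.mem_top _
      | inr v =>
        by_cases hv : (Sum.inr v : Place K) ∈ S₁
        · rw [h𝓣top v hv]; exact AddSubgroup.mem_top _
        · rw [h𝓣ur v hv]; exact h v hv
  let A₁ : AddSubgroup (galoisCohomology (ρ.tateDual n) 1) := 𝓣.selmerGroup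
  let β₁ : galoisCohomology (ρ.tateDual n) 1 →+ (∀ v, Bv v) :=
    AddMonoidHom.pi fun v => galoisCohomology.localization (ρ.tateDual n)
      (Sum.inr (v : HeightOneSpectrum (𝓞 K))) 1
  have hβ₁ : ∀ y (v : Sf), β₁ y v =
      galoisCohomology.localization (ρ.tateDual n) (Sum.inr (v : HeightOneSpectrum (𝓞 K))) 1 y :=
    fun _ _ => rfl
  let f₁ : A₁ →+ (β₁.comp A₁.subtype).range := (β₁.comp A₁.subtype).rangeRestrict
  have hf₁ : Surjective f₁ := AddMonoidHom.rangeRestrict_surjective _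
  have hf₁val : ∀ y : A₁, (f₁ y : ∀ v, Bv v) = β₁ y := fun y => rfl
  have hkerf₁ : f₁.ker ≤ (φ.comp A₁.subtype).ker := by
    intro y hy
    rw [AddMonoidHom.mem_ker] at hy ⊢
    have hy0 : β₁ (y : galoisCohomology (ρ.tateDual n) 1) = 0 := by
      rw [← hf₁val, hy]; rfl
    rw [AddMonoidHom.comp_apply, AddSubgroup.coe_subtype]
    refine hφ _ ((hmem𝓣 _).1 y.2) fun v hv => ?_
    have := congr_fun hy0 ⟨v, (hSf v).2 hv⟩
    rwa [hβ₁, Pi.zero_apply] at this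
  let χ : (β₁.comp A₁.subtype).range →+ ZMod n := f₁.liftOfSurjective hf₁ ⟨φ.comp A₁.subtype, hkerf₁⟩
  have hχ : ∀ y : A₁, χ (f₁ y) = φ y := fun y =>
    AddMonoidHom.liftOfRightInverse_comp_apply f₁ _ _ ⟨φ.comp A₁.subtype, hkerf₁⟩ y
  obtain ⟨t1, ht1⟩ := exists_apply_eq_of_bijective hBn bS hbSbij (β₁.comp A₁.subtype).range χ
  -- extend `t1` by zero off `Sf`
  refine ⟨fun v => if h : v ∈ Sf then t1 ⟨v, h⟩ else 0, fun y hy => ?_⟩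
  have hyA : y ∈ A₁ := (hmem𝓣 y).2 hy
  have hmem : β₁ y ∈ (β₁.comp A₁.subtype).range := ⟨⟨y, hyA⟩, rfl⟩
  have h1 := ht1 (β₁ y) hmem
  rw [hbS] at h1
  have h2 : χ ⟨β₁ y, hmem⟩ = φ y := by
    have h3 := hχ ⟨y, hyA⟩
    have h4 : f₁ ⟨y, hyA⟩ = ⟨β₁ y, hmem⟩ := Subtype.ext rfl
    rwa [h4] at h3
  rw [← h2, ← h1, ← Finset.sum_coe_sort Sf]
  refine Finset.sum_congr rfl fun v _ => ?_
  simp only [dif_pos v.2]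
  rfl

end OnS

/-! ## §4 Complex places carry no `H¹` -/

section Complex

variable {K : Type u} [Field K] [NumberField K] {M : Type u} [AddCommGroup M] [TopologicalSpace M]
  [DiscreteTopology M]

/-- **At a complex place `H¹(K_w, M) = 0`**: `Γ_{K_w}` is trivial (`eq_one_absoluteGaloisGroup_of_isComplex`),
so every continuous crossed homomorphism vanishes. [cite: MilneADT2006, Ch. I, Rem. 3.7] -/
theorem localization_inl_one_eq_zero_of_isComplex (ρ : DiscreteGaloisModule K M) {w : InfinitePlace K}
    (hw : w.IsComplex) (c : galoisCohomology ρ 1) :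
    galoisCohomology.localization ρ (Sum.inl w) 1 c = 0 := by
  haveI : Subsingleton (galoisCohomology (ρ.toLocal (Sum.inl w)) 1) := by
    refine ⟨fun a b => ?_⟩
    obtain ⟨φ, rfl⟩ := oneCocycleClass_surjective _ a
    obtain ⟨ψ, rfl⟩ := oneCocycleClass_surjective _ b
    congr 1
    refine Subtype.ext (ContinuousMap.ext fun σ => ?_)
    rw [eq_one_absoluteGaloisGroup_of_isComplex hw σ, contOneCocycles.apply_one, contOneCocycles.apply_one]
  exact Subsingleton.elim _ _

/-- For a totally complex `K`, a class of `H¹(K, M)` lies in `Ш¹(K, M)` as soon as it vanishes at the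
FINITE places. [cite: MilneADT2006, Ch. I §4, Thm. 4.10 (a)] -/
theorem mem_sha_of_forall_localization_inr_eq_zero [IsTotallyComplex K] (ρ : DiscreteGaloisModule K M)
    (c : galoisCohomology ρ 1)
    (hc : ∀ v : HeightOneSpectrum (𝓞 K), galoisCohomology.localization ρ (Sum.inr v) 1 c = 0) :
    c ∈ ρ.sha := by
  rw [DiscreteGaloisModule.mem_sha_iff]
  intro v
  cases v with
  | inl w => exact localization_inl_one_eq_zero_of_isComplex ρ (IsTotallyComplex.isComplex w) c
  | inr v => exact hc v

end Complex

end Summit.BirchSwinnertonDyer.BirchSwinnertonDyer.Theorems.PoitouTateShaAnnihilator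

end
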